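import Mathlib
import Summits.HubbardSuperconductivity.HubbardSuperconductivity.Theorems.WeakCouplingBCSKlLindhardSRepFold
import Literature.Analysis.SpecialFunctions.EllipticKLogSharp
import HarnessLib

/-!
# The square-lattice `s`-representation at its fold, II: the logarithmic form of the DOS mass near the Kohn sheet

# Route `WeakCouplingBCS` — certificate half of stmt-HubbardSuperconductivity-0158 (t′ = 0 enclosure discharge, crux-idea «caustic-closed-form-row»).

Cell `gate-hubbard-kl`; filed by prover seat p4 g25 (pen (R511)(A)) under `Summits/…/Theorems/` — RE-HOMED from the planner's
Literature-shaped turnkey (`Literature/MathematicalPhysics/QuantumLattice/LindhardSRepFoldLog.lean`, hubbard-klscan-idea-4 g13 r13 ADDENDUM 5b,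
sha16 0ccf182363909fa1) next to part I (✓ `…WeakCouplingBCSKlLindhardSRepFold.lean`): these fold/log facts are the cell's own analysis of the
free integrand («new results belong under Summits/<Summit>/», `lint.literature-cited-only`); namespace `Summit.HubbardSuperconductivity.HubbardSuperconductivity.Theorems`
with `open Literature.MathematicalPhysics.QuantumLattice`; statements and proofs byte-identical to the turnkey.
 With the sharp two-sided logarithmic bound for `K` near
`m = 1` (`Literature.Analysis.SpecialFunctions.ellipticK_sub_log_mem`, `EllipticKLogSharp.lean`:
`0 ≤ K(m) − ½log(16/(1−m)) ≤ ¼(1−m)·½log(16/(1−m))` on `[1/2, 1)`),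
the DOS mass `anisoDOSMass μ a b` of `LindhardEllipticClosedForm.lean` is
`(4/√P)·log(16P/X)·(1+ρ)`, `0 ≤ ρ ≤ X/(4P)`, on the inner side `0 < X ≤ P/2` (`anisoDOSMass_inner_log`) and
`(1/√(ab))·log(256ab/(−X))·(1+ρ)`, `0 ≤ ρ ≤ −X/(64ab)`, on the outer side `0 < −X ≤ 8ab`
(`anisoDOSMass_outer_log`), with matching prefactors at the sheet (`prefactor_match`): a TWO-SIDED sharpening,
with vanishing relative remainder, of the one-sided majorant (B2) `anisoDOSMass_le_log` of
`AnisotropicBandDOSBounds.lean` (constant `2 log(1+√2)`). `X = 4(a−b)² − μ²`, `P = 4(a+b)² − μ²`.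

Provenance: cell gate-hubbard-kl, planner seat hubbard-klscan-idea-4 g13, §11 of the crux-idea sketch
«caustic-closed-form-row» on stmt-HubbardSuperconductivity-0158 (the certified `κ` of its model integrals).

## References
* [RaghuKivelsonScalapino2010] S. Raghu, S. A. Kivelson, D. J. Scalapino, Phys. Rev. B 81 (2010) 224505,
  §II (5)–(6) (the square-lattice Lindhard / DOS objects).
* [BorweinBorwein1987] J. M. Borwein, P. B. Borwein, *Pi and the AGM* (1987), §1.3 (1.3.10) (the `K` asymptotics).
* Cell note CERT-SREP §1–§2 (gate-hubbard-kl, 2026), identity (I1) and the bounds (B1)–(B2).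
-/

noncomputable section

-- the tree's namespace `Summit.<Summit>.<Problem>.Theorems` repeats the summit name by design (D-0017)
set_option linter.dupNamespace false

open Real _root_.MeasureTheory _root_.Set
open Literature.Probability.RandomPlanarGeometry Literature.Analysis.SpecialFunctions Literature.MathematicalPhysics.QuantumLattice

namespace Summit.HubbardSuperconductivity.HubbardSuperconductivity.Theorems

/-! ### (d) K2 ∘ (I1): the DOS mass is `prefactor · log(const/|X|)` near the Kohn sheet, both sides -/

/-- `|x| < y ⟹ x² < y²` for `0 ≤ y`-free use (`y` is forced nonnegative). [folklore] -/
private theorem sq_lt_of_abs_lt {x y : ℝ} (h : |x| < y) : x ^ 2 < y ^ 2 := by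
  have hy : 0 ≤ y := (abs_nonneg x).trans h.le
  have := mul_self_lt_mul_self (abs_nonneg x) h
  nlinarith [abs_mul_abs_self x]

/-- **Inner branch (`X > 0`, inside the van Hove energy).** For `|μ| < 2|a−b|` and `2X ≤ P` (parameter
`m = 16ab/P ∈ [½, 1)`; no sign hypothesis on `a, b`): `σ_{a,b,μ}(ℝ²) = (4/√P)·log(16P/X)·(1 + ρ)`, `0 ≤ ρ ≤ X/(4P)`.
[cite: RaghuKivelsonScalapino2010, §II (5)–(6)] -/
theorem anisoDOSMass_inner_log {a b μ : ℝ}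
    (hin : |μ| < 2 * |a - b|) (h2X : 2 * (4 * (a - b) ^ 2 - μ ^ 2) ≤ 4 * (a + b) ^ 2 - μ ^ 2) :
    0 ≤ anisoDOSMass μ a b -
        4 * Real.log (16 * (4 * (a + b) ^ 2 - μ ^ 2) / (4 * (a - b) ^ 2 - μ ^ 2)) /
          Real.sqrt (4 * (a + b) ^ 2 - μ ^ 2) ∧
      anisoDOSMass μ a b -
          4 * Real.log (16 * (4 * (a + b) ^ 2 - μ ^ 2) / (4 * (a - b) ^ 2 - μ ^ 2)) /
            Real.sqrt (4 * (a + b) ^ 2 - μ ^ 2) ≤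
        (4 * (a - b) ^ 2 - μ ^ 2) / (4 * (4 * (a + b) ^ 2 - μ ^ 2)) *
          (4 * Real.log (16 * (4 * (a + b) ^ 2 - μ ^ 2) / (4 * (a - b) ^ 2 - μ ^ 2)) /
            Real.sqrt (4 * (a + b) ^ 2 - μ ^ 2)) := by
  set P := 4 * (a + b) ^ 2 - μ ^ 2 with hP
  set X := 4 * (a - b) ^ 2 - μ ^ 2 with hX
  have hX0 : 0 < X := by
    have h1 := sq_lt_of_abs_lt hin
    rw [hX]; nlinarith [sq_abs (a - b)]
  have hPX : P - X = 16 * a * b := by rw [hP, hX]; ring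
  have hP0 : 0 < P := by linarith
  have hPne : P ≠ 0 := hP0.ne'
  have hXne : X ≠ 0 := hX0.ne'
  have hm_def : 16 * a * b / P = 1 - X / P := by
    rw [← hPX, sub_div, div_self hPne]
  have hm1 : 16 * a * b / P < 1 := by
    rw [hm_def]; have := div_pos hX0 hP0; linarith
  have hmh : 1 / 2 ≤ 16 * a * b / P := by
    rw [hm_def]
    have : X / P ≤ 1 / 2 := by rw [div_le_iff₀ hP0]; linarith
    linarith
  obtain ⟨hlo, hhi⟩ := ellipticK_sub_log_mem hmh hm1
  have h1m : 1 - 16 * a * b / P = X / P := by rw [hm_def]; ring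
  have hlog : Real.log (16 / (1 - 16 * a * b / P)) = Real.log (16 * P / X) := by
    rw [h1m, div_div_eq_mul_div]
  rw [hlog] at hlo hhi
  rw [h1m] at hhi
  have hmass : anisoDOSMass μ a b = 8 * ellipticK (16 * a * b / P) / Real.sqrt P := by
    unfold anisoDOSMass; rw [if_pos hin]
  have hsP : 0 < Real.sqrt P := Real.sqrt_pos.2 hP0
  rw [hmass]
  have e1 : 8 * ellipticK (16 * a * b / P) / Real.sqrt P - 4 * Real.log (16 * P / X) / Real.sqrt P =
      (8 / Real.sqrt P) * (ellipticK (16 * a * b / P) - Real.log (16 * P / X) / 2) := by ring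
  constructor
  · rw [e1]; exact mul_nonneg (by positivity) hlo
  · have e2 : X / (4 * P) * (4 * Real.log (16 * P / X) / Real.sqrt P) =
        (8 / Real.sqrt P) * (X / P / 4 * (Real.log (16 * P / X) / 2)) := by
      field_simp
      ring
    rw [e1, e2]
    exact mul_le_mul_of_nonneg_left hhi (by positivity)

/-- **Outer branch (`X < 0`, between the van Hove energy and the band edge).** For `a, b > 0`,
`2|a−b| < |μ| < 2(a+b)` and `2Y ≤ 16ab`, `Y = −X = μ² − 4(a−b)²` (parameter `m′ = P/(16ab) ≥ ½`):
`σ_{a,b,μ}(ℝ²) = (1/√(ab))·log(256ab/Y)·(1 + ρ)`, `0 ≤ ρ ≤ Y/(64ab)`.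
[cite: RaghuKivelsonScalapino2010, §II (5)–(6)] -/
theorem anisoDOSMass_outer_log {a b μ : ℝ} (ha : 0 < a) (hb : 0 < b)
    (hge : 2 * |a - b| < |μ|) (hout : |μ| < 2 * (a + b))
    (h2Y : 2 * (μ ^ 2 - 4 * (a - b) ^ 2) ≤ 16 * a * b) :
    0 ≤ anisoDOSMass μ a b - Real.log (256 * (a * b) / (μ ^ 2 - 4 * (a - b) ^ 2)) / Real.sqrt (a * b) ∧
      anisoDOSMass μ a b - Real.log (256 * (a * b) / (μ ^ 2 - 4 * (a - b) ^ 2)) / Real.sqrt (a * b) ≤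
        (μ ^ 2 - 4 * (a - b) ^ 2) / (64 * (a * b)) *
          (Real.log (256 * (a * b) / (μ ^ 2 - 4 * (a - b) ^ 2)) / Real.sqrt (a * b)) := by
  set Y := μ ^ 2 - 4 * (a - b) ^ 2 with hY
  have hab : 0 < a * b := mul_pos ha hb
  have habne : a * b ≠ 0 := hab.ne'
  have hY0 : 0 < Y := by
    have h0 : 0 ≤ 2 * |a - b| := by positivity
    have h1 := mul_self_lt_mul_self h0 hge
    rw [hY]; nlinarith [abs_mul_abs_self μ, abs_mul_abs_self (a - b)]
  have hYne : Y ≠ 0 := hY0.ne'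
  have hnot : ¬ (|μ| < 2 * |a - b|) := not_lt.2 hge.le
  have hmass : anisoDOSMass μ a b =
      2 * ellipticK ((4 * (a + b) ^ 2 - μ ^ 2) / (16 * a * b)) / Real.sqrt (a * b) := by
    unfold anisoDOSMass; rw [if_neg hnot, if_pos hout]
  have hm_def : (4 * (a + b) ^ 2 - μ ^ 2) / (16 * a * b) = 1 - Y / (16 * (a * b)) := by
    rw [hY]; field_simp; ring
  have hm1 : (4 * (a + b) ^ 2 - μ ^ 2) / (16 * a * b) < 1 := by
    rw [hm_def]; have := div_pos hY0 (by positivity : (0:ℝ) < 16 * (a * b)); linarith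
  have hmh : 1 / 2 ≤ (4 * (a + b) ^ 2 - μ ^ 2) / (16 * a * b) := by
    rw [hm_def]
    have : Y / (16 * (a * b)) ≤ 1 / 2 := by
      rw [div_le_iff₀ (by positivity : (0:ℝ) < 16 * (a * b))]; linarith
    linarith
  obtain ⟨hlo, hhi⟩ := ellipticK_sub_log_mem hmh hm1
  have h1m : 1 - (4 * (a + b) ^ 2 - μ ^ 2) / (16 * a * b) = Y / (16 * (a * b)) := by rw [hm_def]; ring
  have hlog : Real.log (16 / (1 - (4 * (a + b) ^ 2 - μ ^ 2) / (16 * a * b))) =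
      Real.log (256 * (a * b) / Y) := by
    rw [h1m, div_div_eq_mul_div]; congr 1; ring
  rw [hlog] at hlo hhi
  rw [h1m] at hhi
  have hsab : 0 < Real.sqrt (a * b) := Real.sqrt_pos.2 hab
  rw [hmass]
  have e1 : 2 * ellipticK ((4 * (a + b) ^ 2 - μ ^ 2) / (16 * a * b)) / Real.sqrt (a * b) -
        Real.log (256 * (a * b) / Y) / Real.sqrt (a * b) =
      (2 / Real.sqrt (a * b)) * (ellipticK ((4 * (a + b) ^ 2 - μ ^ 2) / (16 * a * b)) -
        Real.log (256 * (a * b) / Y) / 2) := by ring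
  constructor
  · rw [e1]; exact mul_nonneg (by positivity) hlo
  · have e2 : Y / (64 * (a * b)) * (Real.log (256 * (a * b) / Y) / Real.sqrt (a * b)) =
        (2 / Real.sqrt (a * b)) * (Y / (16 * (a * b)) / 4 * (Real.log (256 * (a * b) / Y) / 2)) := by
      field_simp
      ring
    rw [e1, e2]
    exact mul_le_mul_of_nonneg_left hhi (by positivity)

/-- Continuity of the logarithmic PREFACTOR across the sheet: at `X = 0`, `P = 16ab`, so `4/√P = 1/√(ab)`.
[cite: RaghuKivelsonScalapino2010, §II (5)–(6)] -/
theorem prefactor_match {a b : ℝ} (ha : 0 < a) (hb : 0 < b) :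
    4 / Real.sqrt (16 * a * b) = 1 / Real.sqrt (a * b) := by
  rw [show (16 : ℝ) * a * b = 4 ^ 2 * (a * b) by ring, Real.sqrt_mul (by norm_num), Real.sqrt_sq (by norm_num)]
  field_simp

end Summit.HubbardSuperconductivity.HubbardSuperconductivity.Theorems

end
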